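import Summits.HubbardSuperconductivity.HubbardSuperconductivity.Theses.DeformationLadder
import Summits.HubbardSuperconductivity.HubbardSuperconductivity.Theorems.ChiralWindowCwEveryFromSomePenalised
import Summits.HubbardSuperconductivity.HubbardSuperconductivity.Theorems.TwTipContinuation.Negative.TipNormalForm

/-!
# Route `DeformationLadder` — assembly item `Assembly` (stmt-HubbardSuperconductivity-1891)

`Assembly : LadderThesis-body → HubbardSuperconductivity`. The thesis `X` delivers `U > 0`,
`δ ∈ (0, 1/2)`, `s > 0`, `a > 0`, `L₀` such that at every even side `L ≥ L₀` SOME normalised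
`(N_L, S^z = 0)`-sector ground state `φ` of the PENALISED pure model
`hubbardTorus 2 L 1 U + (s/L⁴) • (pFᴴ pF)` (`pF = pairField dWaveFormFactor L`,
`N_L = 2⌊(1-δ)L²/2⌋`) has `a ≤ L⁻⁴ re ⟨φ, pFᴴ pF φ⟩`.

* Kaplan–Horsch–von der Linden two-line variational lemma (the tree's abstract
  `re_penalty_le_of_sector_groundStates`, `Theorems/ChiralWindowCwEveryFromSomePenalised.lean`):
  with `c = s/L⁴ > 0`, every normalised sector ground state `ψ` of the pure `H` in the same
  sector has `re ⟨φ, P φ⟩ ≤ re ⟨ψ, P ψ⟩`, hence `a L⁴ ≤ re ⟨ψ, pFᴴ pF ψ⟩` for EVERY such `ψ`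
  (`deformationLadder_everyGS_floor`).
* The even-side `liminf` bookkeeping turning this uniform every-ground-state floor into the
  summit's matrix at `(U, δ)` is the tree's `summitMatrix_of_everyGSOrder`
  (`Theorems/TwTipContinuation/Negative/TipNormalForm.lean`: `lroTerm_eq`, the a-priori bound
  `expect_pairIntensity_le` keeping Mathlib's real `liminf` off its junk value, `le_liminf_of_le`).

Sources: T. A. Kaplan, P. Horsch, W. von der Linden, J. Phys. Soc. Jpn. 58 (1989) 3894;
D. J. Scalapino, Phys. Rep. 250 (1995) 329, §2. No new definitions.
-/

-- the mandated namespace `Summit.<Summit>.<Problem>.Theorems` repeats `HubbardSuperconductivity`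
-- (single-problem summit, D-0017), which the `dupNamespace` linter flags on every declaration
set_option linter.dupNamespace false

namespace Summit.HubbardSuperconductivity.HubbardSuperconductivity.Theorems

open Matrix Literature.MathematicalPhysics.QuantumLattice
open Summit.HubbardSuperconductivity.TwTipContinuation.Negative (summitMatrix_of_everyGSOrder)

/-- **Every pure ground state inherits the penalised floor** (Kaplan–Horsch–von der Linden at one
side). At side `L ≥ 1`, coupling `U`, penalty strength `s > 0` and sector `(N, S^z = 0)`: if a
normalised sector ground state `φ` of `hubbardTorus 2 L 1 U + (s/L⁴) • (pFᴴ pF)` has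
`a ≤ L⁻⁴ re ⟨φ, pFᴴ pF φ⟩`, then every normalised sector ground state `ψ` of `hubbardTorus 2 L 1 U`
has `a L⁴ ≤ re ⟨ψ, pFᴴ pF ψ⟩`. Proof: `re ⟨φ, P φ⟩ ≤ re ⟨ψ, P ψ⟩` by
`re_penalty_le_of_sector_groundStates` (Hermiticity of `H` and `P = pFᴴ pF`, `s/L⁴ > 0`).
Kaplan–Horsch–von der Linden, J. Phys. Soc. Jpn. 58 (1989) 3894. [folklore] -/
theorem deformationLadder_everyGS_floor (L : ℕ) [NeZero L] (U : ℝ) {s a : ℝ} (hs : 0 < s)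
    (N : ℕ) {φ ψ : Fock (Orb (FermionTorus 2 L))} (hφ1 : star φ ⬝ᵥ φ = 1)
    (hφ : IsGroundStateInSector (hubbardTorus 2 L 1 U + ((s / (L : ℝ) ^ 4 : ℝ) : ℂ) •
      (Matrix.conjTranspose (pairField dWaveFormFactor L) * pairField dWaveFormFactor L)) N 0 φ)
    (ha : a ≤ (expect (Matrix.conjTranspose (pairField dWaveFormFactor L) *
      pairField dWaveFormFactor L) φ).re / (L : ℝ) ^ 4)
    (hψ1 : star ψ ⬝ᵥ ψ = 1) (hψ : IsGroundStateInSector (hubbardTorus 2 L 1 U) N 0 ψ) :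
    a * (L : ℝ) ^ 4 ≤
      (expect (Matrix.conjTranspose (pairField dWaveFormFactor L) * pairField dWaveFormFactor L)
        ψ).re := by
  have hL : (0 : ℝ) < (L : ℝ) := Nat.cast_pos.2 (Nat.pos_of_ne_zero (NeZero.ne L))
  have hL4 : (0 : ℝ) < (L : ℝ) ^ 4 := by positivity
  have hsL : 0 < s / (L : ℝ) ^ 4 := div_pos hs hL4
  have key := re_penalty_le_of_sector_groundStates
    (hubbardTorus_isHermitian (hamiltonian_isHermitian_and_commute_holds _) 1 U)
    (isHermitian_conjTranspose_mul_self (pairField dWaveFormFactor L)) hsL (szSector N 0)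
    hφ.1 hψ.1 hφ.2.2 hψ.2.2 hφ1 hψ1
  rw [le_div_iff₀ hL4] at ha
  unfold expect at ha ⊢
  linarith

/-- **Assembly of route `DeformationLadder`** (stmt-HubbardSuperconductivity-1891): the route
thesis `X` (for some `U > 0`, `δ ∈ (0, 1/2)`, `s > 0`, `a > 0` and all large even `L`, SOME
normalised `(N_L, S^z = 0)`-sector ground state of the penalised pure model
`hubbardTorus 2 L 1 U + (s/L⁴) • (pFᴴ pF)` has d-wave LRO density `L⁻⁴ re ⟨pFᴴ pF⟩ ≥ a`) implies
the summit statement `HubbardSuperconductivity` (`= Literature.Hubbard.DWaveSuperconductivityHubbard`)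
with the SAME `(U, δ)`: by `deformationLadder_everyGS_floor` every normalised sector ground state
of the pure model at every even `L ≥ L₀` has `a L⁴ ≤ re ⟨ψ, pFᴴ pF ψ⟩`, and the even-side `liminf`
bookkeeping `summitMatrix_of_everyGSOrder` gives the summit's matrix. Kaplan–Horsch–von der Linden,
J. Phys. Soc. Jpn. 58 (1989) 3894; Scalapino, Phys. Rep. 250 (1995) 329, §2. [folklore] -/
theorem deformationLadder_assembly_proof :
    Summit.HubbardSuperconductivity.HubbardSuperconductivity.Theses.DeformationLadder.Assembly := by
  unfold Summit.HubbardSuperconductivity.HubbardSuperconductivity.Theses.DeformationLadder.Assembly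
    _root_.HubbardSuperconductivity Literature.Hubbard.DWaveSuperconductivityHubbard
  rintro ⟨U, hU, δ, hδ, s, hs, a, ha, L₀, hX⟩
  refine ⟨U, hU, δ, hδ, summitMatrix_of_everyGSOrder ⟨a, ha, L₀, ?_⟩⟩
  intro L inst hL₀ hE ψ hψ1 hψ
  obtain ⟨φ, hφ1, hφ, hφa⟩ := hX L hL₀ hE
  exact deformationLadder_everyGS_floor L U hs _ hφ1 hφ hφa hψ1 hψ

end Summit.HubbardSuperconductivity.HubbardSuperconductivity.Theorems
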